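import Summits.Ventures.Crystal3D.Theorems.StickyWulffConstantNoReconstructionGainGrainSchedule
import Summits.Ventures.Crystal3D.Theorems.StickyWulffConstantNoReconstructionGainCertificate
import HarnessLib

/-!
# Segment counting for misoriented Barlow grains at a general normal: the end-credit reduction

HONEST FRAMING. Part of the venture `Summits/Ventures/Crystal3D` (cell `crystal3d-full`), helper
`--supports` the crux `NoReconstructionGain` (stmt-Ventures-19144, route
`route-Ventures-StickyWulffConstant`), line `adhesion` (wulff-p1 g13).  The grain rung of g4
(`…GrainAdhesion`, normal `e₃`) counted SEGMENTS of the six transport families of a Barlow stacking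
(`sum_card_adj_add`, `…GrainFamilies`): the contact deficiency of a film `Q` drawn from a moved stacking
equals the number of maximal segments, and every segment has exactly one END of each kind.  This file
turns that identity into a normal-free REDUCTION with the weakest possible local input:

* `card_filter_image_not_mem_eq` — tops = bottoms for a bijective step (`…GrainCount` restated with an
  explicit inverse);
* `barlowGrain_cross_le_of_endCredits` — **the end-credit reduction.**  `X ⊇ P` a finite unit packing whose
  film `X ∖ P` lies in `A · barlowStacking 1 √(2/3) σ + c`.  Fix, ONCE FOR THE WHOLE GRAIN, an orientation
  of each in-layer line family (`s₁ s₂ s₃ : Bool`) and credit the chain families at their UPPER ends.  If every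
  film ball `q = A·pos(k,i,j) + c` has at most as many substrate contacts as it has EMPTY END SLOTS — the
  chosen in-layer neighbour site of each of the three line families and the three up-neighbour sites
  `(k+1, (i,j) − o)`, `o ∈ threeOffsets(−σ k)`, that carry no film ball — then
  `#cross(P, X∖P) ≤ D(X∖P)` (no error term, no normal, no cone).
  Reading the grain backwards (reversed Hägg word under the basal mirror, `…BarlowGrainFilmCone`)
  turns "up-neighbour" credits into "down-neighbour" credits, so both stacking readings are covered.

Why this is the right reduction (g13 census, kit j310391/j310427/j310445/j310478/j310520, evidence on the
item): an end slot is CERTIFIED empty when it is blocked by one of the ball's own substrate contacts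
(`⟪p − q, b⟫ > 1/2`) or submerged below the cut; with that certificate the hypothesis is a per-toucher
"pred-slot budget".  In the basal cone it is the landed cap budget; beyond the cone the census finds, for
every sampled grain orientation and normal, one of the two stacking readings under which every physical
toucher passes — interior balls need nothing (no interstitial bonds, no pairing).

WHAT THIS IS NOT: the budget itself (a spherical-code lemma about the moved hexagon and triple versus
`≤ 3` lattice contacts) — open beyond the basal cone; rung F-C1 not moved.
-/

noncomputable section

namespace Summit.Ventures.Crystal3D.Theorems

open Summit.Ventures.Crystal3D Finset Real
open Literature.MathematicalPhysics.StatisticalMechanics (barlowPos barlowStacking fccStacking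
  IsHaggSeq threeOffsets orderedContacts contactDeficiency le_dist_barlowPos_of_ideal card_threeOffsets)
open scoped InnerProductSpace

/-- **Tops = bottoms with an explicit inverse.**  For a step `T` with two-sided inverse `S` and a finite
set `Q`: `#{z ∈ Q : T z ∉ Q} = #{z ∈ Q : S z ∉ Q}`. -/
theorem card_filter_image_not_mem_eq {ι : Type*} [DecidableEq ι] (Q : Finset ι) (T S : ι → ι)
    (hST : ∀ z, S (T z) = z) (hTS : ∀ z, T (S z) = z) :
    (Q.filter fun z => T z ∉ Q).card = (Q.filter fun z => S z ∉ Q).card := by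
  have hT : Function.Injective T := fun a b h => by rw [← hST a, ← hST b, h]
  rw [card_filter_succ_not_mem_eq Q T hT]
  refine congrArg _ (filter_congr fun z _ => ?_)
  constructor
  · intro h hS
    exact h (mem_image.2 ⟨S z, hS, hTS z⟩)
  · rintro h hz
    obtain ⟨w, hw, hwz⟩ := mem_image.1 hz
    apply h
    rw [← hwz, hST]; exact hw

/-- **THE END-CREDIT REDUCTION (segment counting at a general normal).**  See the module docstring. -/
theorem barlowGrain_cross_le_of_endCredits {σ : ℤ → ℤ} (hσ : IsHaggSeq σ)
    (A : EuclideanSpace ℝ (Fin 3) ≃ₗᵢ[ℝ] EuclideanSpace ℝ (Fin 3)) (c : EuclideanSpace ℝ (Fin 3))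
    (s₁ s₂ s₃ : Bool) (X P : Finset (EuclideanSpace ℝ (Fin 3)))
    (hgrain : ∀ q ∈ X \ P, q ∈ (fun p => A p + c) '' barlowStacking 1 (Real.sqrt (2 / 3)) σ)
    (hcred : ∀ k i j : ℤ, A (barlowPos 1 (Real.sqrt (2 / 3)) σ k i j) + c ∈ X \ P →
      ((P.filter fun p => dist (A (barlowPos 1 (Real.sqrt (2 / 3)) σ k i j) + c) p = 1).card : ℝ) ≤
        (if A (barlowPos 1 (Real.sqrt (2 / 3)) σ k (i + (if s₁ then 1 else -1)) j) + c ∉ X \ P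
          then (1 : ℝ) else 0) +
        (if A (barlowPos 1 (Real.sqrt (2 / 3)) σ k i (j + (if s₂ then 1 else -1))) + c ∉ X \ P
          then (1 : ℝ) else 0) +
        (if A (barlowPos 1 (Real.sqrt (2 / 3)) σ k (i + (if s₃ then 1 else -1))
            (j + (if s₃ then -1 else 1))) + c ∉ X \ P then (1 : ℝ) else 0) +
        (((threeOffsets (-σ k)).filter fun o =>
          A (barlowPos 1 (Real.sqrt (2 / 3)) σ (k + 1) (i - o.1) (j - o.2)) + c ∉ X \ P).card : ℝ)) :
    ((((P ×ˢ (X \ P)).filter fun pq => dist pq.1 pq.2 = 1).card : ℕ) : ℝ) ≤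
      contactDeficiency (X \ P) := by
  classical
  have hh' : Real.sqrt (2 / 3) ^ 2 = 2 / 3 * (1 : ℝ) ^ 2 := by rw [Real.sq_sqrt (by norm_num)]; ring
  set Q := X \ P with hQ
  /- ### 1. The grain in coordinates -/
  set pos : ℤ × ℤ × ℤ → EuclideanSpace ℝ (Fin 3) :=
    fun z => barlowPos 1 (Real.sqrt (2 / 3)) σ z.1 z.2.1 z.2.2 with hposdef
  set gp : ℤ × ℤ × ℤ → EuclideanSpace ℝ (Fin 3) := fun z => A (pos z) + c with hgpdef
  have hgp_dist : ∀ z w, dist (gp z) (gp w) = dist (pos z) (pos w) := by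
    intro z w; simp only [hgpdef]; rw [dist_add_right, LinearIsometryEquiv.dist_map]
  have hgp_inj : Function.Injective gp := by
    intro z w hzw
    by_contra hne
    have hne' : (z.1, z.2.1, z.2.2) ≠ (w.1, w.2.1, w.2.2) := by
      intro h0
      apply hne
      simp only [Prod.mk.injEq] at h0
      exact Prod.ext h0.1 (Prod.ext h0.2.1 h0.2.2)
    have h1 := le_dist_barlowPos_of_ideal hσ one_pos hh' hne'
    have h0 : dist (gp z) (gp w) = 0 := by rw [hzw, dist_self]
    rw [hgp_dist] at h0
    simp only [hposdef] at h0
    linarith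
  have hrange : ∀ q ∈ Q, ∃ z, gp z = q := by
    intro q hq
    obtain ⟨p, ⟨k, i, j, rfl⟩, hp⟩ := hgrain q hq
    exact ⟨(k, i, j), hp⟩
  set Q' : Finset (ℤ × ℤ × ℤ) := Q.preimage gp hgp_inj.injOn with hQ'def
  have hmemQ' : ∀ z, z ∈ Q' ↔ gp z ∈ Q := fun z => by rw [hQ'def, mem_preimage]
  have hQ'img : Q'.image gp = Q := by
    rw [hQ'def, image_preimage]
    refine filter_true_of_mem fun q hq => ?_
    obtain ⟨z, hz⟩ := hrange q hq
    exact ⟨z, hz⟩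
  have hQ'card : Q'.card = Q.card := by rw [← hQ'img, card_image_of_injective _ hgp_inj]
  /- ### 2. Ordered contacts of `Q` as the degree sum over sites -/
  have hoc : (orderedContacts Q : ℝ) = ∑ z ∈ Q', ((Q'.filter fun w =>
      dist (pos z) (pos w) = 1).card : ℝ) := by
    rw [orderedContacts_eq_sum_sum, ← hQ'img, sum_image fun z _ w _ hzw => hgp_inj hzw]
    refine sum_congr rfl fun z _ => ?_
    rw [sum_image fun z _ w _ hzw => hgp_inj hzw]
    have : ∀ w ∈ Q', (if dist (gp z) (gp w) = 1 then (1 : ℝ) else 0) =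
        (if dist (pos z) (pos w) = 1 then (1 : ℝ) else 0) := fun w _ => by rw [hgp_dist]
    rw [sum_congr rfl this, Finset.sum_boole]
  /- ### 3. A schedule and the segment formula -/
  obtain ⟨off, -, hmem, hinj⟩ := exists_schedule hσ (fun _ => ((0 : ℤ), (0 : ℤ)))
    (fun s hs => by rcases hs with rfl | rfl <;> simp [threeOffsets])
  have hD : contactDeficiency Q = ((Q'.filter fun z => (z.1, z.2.1 + 1, z.2.2) ∉ Q').card : ℝ) +
        ((Q'.filter fun z => (z.1, z.2.1, z.2.2 + 1) ∉ Q').card : ℝ) +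
        ((Q'.filter fun z => (z.1, z.2.1 + 1, z.2.2 - 1) ∉ Q').card : ℝ) +
        ∑ m : Fin 3, ((Q'.filter fun z =>
          (z.1 + 1, z.2.1 - (off m z.1).1, z.2.2 - (off m z.1).2) ∉ Q').card : ℝ) := by
    have hid := sum_card_adj_add hσ off hmem hinj Q'
    have hid' : (∑ z ∈ Q', ((Q'.filter fun w => dist (pos z) (pos w) = 1).card : ℝ)) +
        2 * (((Q'.filter fun z => (z.1, z.2.1 + 1, z.2.2) ∉ Q').card : ℝ) +
          ((Q'.filter fun z => (z.1, z.2.1, z.2.2 + 1) ∉ Q').card : ℝ) +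
          ((Q'.filter fun z => (z.1, z.2.1 + 1, z.2.2 - 1) ∉ Q').card : ℝ) +
          ∑ m : Fin 3, ((Q'.filter fun z =>
            (z.1 + 1, z.2.1 - (off m z.1).1, z.2.2 - (off m z.1).2) ∉ Q').card : ℝ)) =
        12 * (Q'.card : ℝ) := by
      simp only [hposdef]
      exact_mod_cast hid
    unfold contactDeficiency
    rw [hoc, ← hQ'card]
    linarith
  /- ### 4. Orienting the in-layer families -/
  -- each in-layer family may be counted at either end
  have hfam : ∀ (a b : ℤ) (s : Bool),
      ((Q'.filter fun z => (z.1, z.2.1 + a, z.2.2 + b) ∉ Q').card : ℝ) =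
        ∑ z ∈ Q', (if (z.1, z.2.1 + (if s then a else -a), z.2.2 + (if s then b else -b)) ∉ Q'
          then (1 : ℝ) else 0) := by
    intro a b s
    cases s with
    | true => simp only [if_true]; rw [← Finset.sum_boole]
    | false =>
      simp only [Bool.false_eq_true, if_false]
      rw [card_filter_image_not_mem_eq Q' (fun z => (z.1, z.2.1 + a, z.2.2 + b))
        (fun z => (z.1, z.2.1 + -a, z.2.2 + -b))
        (fun z => by obtain ⟨k, i, j⟩ := z; simp only [Prod.mk.injEq]; exact ⟨trivial, by ring, by ring⟩)
        (fun z => by obtain ⟨k, i, j⟩ := z; simp only [Prod.mk.injEq]; exact ⟨trivial, by ring, by ring⟩)]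
      rw [← Finset.sum_boole]
  /- ### 5. The chain families, schedule-free -/
  have hchain : ∑ m : Fin 3, ((Q'.filter fun z =>
        (z.1 + 1, z.2.1 - (off m z.1).1, z.2.2 - (off m z.1).2) ∉ Q').card : ℝ) =
      ∑ z ∈ Q', (((threeOffsets (-σ z.1)).filter fun o =>
        (z.1 + 1, z.2.1 - o.1, z.2.2 - o.2) ∉ Q').card : ℝ) := by
    have h1 : ∀ m : Fin 3, ((Q'.filter fun z =>
        (z.1 + 1, z.2.1 - (off m z.1).1, z.2.2 - (off m z.1).2) ∉ Q').card : ℝ) =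
        ∑ z ∈ Q', (if (z.1 + 1, z.2.1 - (off m z.1).1, z.2.2 - (off m z.1).2) ∉ Q'
          then (1 : ℝ) else 0) := fun m => by rw [← Finset.sum_boole]
    simp only [h1]
    rw [sum_comm]
    refine sum_congr rfl fun z _ => ?_
    -- the schedule at layer `z.1` enumerates `threeOffsets (−σ z.1)` bijectively
    have himg : (univ : Finset (Fin 3)).image (fun m => off m z.1) = threeOffsets (-σ z.1) := by
      apply eq_of_subset_of_card_le
      · intro o ho
        obtain ⟨m, -, rfl⟩ := mem_image.1 ho
        exact hmem m z.1
      · rw [card_image_of_injective _ (hinj z.1), card_univ, Fintype.card_fin, card_threeOffsets]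
    rw [← himg, filter_image, card_image_of_injective _ (hinj z.1), Finset.sum_boole]
  /- ### 6. Assembly -/
  have hfam1 := hfam 1 0 s₁
  have hfam2 := hfam 0 1 s₂
  have hfam3 := hfam 1 (-1) s₃
  simp only [neg_zero, ite_self, add_zero, neg_neg] at hfam1 hfam2 hfam3
  simp only [← sub_eq_add_neg] at hfam3
  have hcross : ((((P ×ˢ Q).filter fun pq => dist pq.1 pq.2 = 1).card : ℕ) : ℝ) =
      ∑ z ∈ Q', ((P.filter fun p => dist (gp z) p = 1).card : ℝ) := by
    rw [card_cross_eq_sum_card_plug_partners P Q, ← hQ'img, sum_image fun z _ w _ hzw => hgp_inj hzw]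
  have hz_cred : ∀ z ∈ Q', ((P.filter fun p => dist (gp z) p = 1).card : ℝ) ≤
      (if (z.1, z.2.1 + (if s₁ then 1 else -1), z.2.2) ∉ Q' then (1 : ℝ) else 0) +
      (if (z.1, z.2.1, z.2.2 + (if s₂ then 1 else -1)) ∉ Q' then (1 : ℝ) else 0) +
      (if (z.1, z.2.1 + (if s₃ then 1 else -1), z.2.2 + (if s₃ then -1 else 1)) ∉ Q' then (1 : ℝ) else 0) +
      (((threeOffsets (-σ z.1)).filter fun o => (z.1 + 1, z.2.1 - o.1, z.2.2 - o.2) ∉ Q').card : ℝ) := by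
    intro z hz
    obtain ⟨k, i, j⟩ := z
    have h := hcred k i j ((hmemQ' (k, i, j)).1 hz)
    simp only [hmemQ', hgpdef, hposdef] at h ⊢
    exact h
  calc ((((P ×ˢ Q).filter fun pq => dist pq.1 pq.2 = 1).card : ℕ) : ℝ)
      = ∑ z ∈ Q', ((P.filter fun p => dist (gp z) p = 1).card : ℝ) := hcross
    _ ≤ ∑ z ∈ Q', ((if (z.1, z.2.1 + (if s₁ then 1 else -1), z.2.2) ∉ Q' then (1 : ℝ) else 0) +
        (if (z.1, z.2.1, z.2.2 + (if s₂ then 1 else -1)) ∉ Q' then (1 : ℝ) else 0) +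
        (if (z.1, z.2.1 + (if s₃ then 1 else -1), z.2.2 + (if s₃ then -1 else 1)) ∉ Q' then (1 : ℝ) else 0) +
        (((threeOffsets (-σ z.1)).filter fun o => (z.1 + 1, z.2.1 - o.1, z.2.2 - o.2) ∉ Q').card : ℝ)) :=
        sum_le_sum hz_cred
    _ = contactDeficiency Q := by
        rw [hD, hfam1, hfam2, hfam3, hchain, ← sum_add_distrib, ← sum_add_distrib, ← sum_add_distrib]

/-- **Certified end slots.**  The geometric form of the reduction: `X ⊇ P` a finite unit packing, the
substrate `P` below the cut `⟪·, ν⟫ ≤ −R`, the film above it and inside `A · barlowStacking 1 √(2/3) σ + c`.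
An end slot `y` (position `A·pos y + c`) of a film ball `q` is CERTIFIED EMPTY if it is blocked by a substrate
contact of `q` (`dist (A·pos y + c) p < 1` for some `p ∈ P` touching `q`) or submerged (`⟪A·pos y + c, ν⟫ ≤ −R`).
If every film ball has at most as many substrate contacts as certified-empty end slots (in-layer ends chosen
by `s₁ s₂ s₃`, chain ends = the three up-neighbours), then `#cross(P, X∖P) ≤ D(X∖P)`. -/
theorem barlowGrain_cross_le_of_slotCertificates {σ : ℤ → ℤ} (hσ : IsHaggSeq σ)
    (A : EuclideanSpace ℝ (Fin 3) ≃ₗᵢ[ℝ] EuclideanSpace ℝ (Fin 3)) (c ν : EuclideanSpace ℝ (Fin 3)) (R : ℝ)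
    (s₁ s₂ s₃ : Bool) (X P : Finset (EuclideanSpace ℝ (Fin 3)))
    (hX : ∀ p ∈ X, ∀ q ∈ X, p ≠ q → 1 ≤ dist p q) (hPX : P ⊆ X)
    (habove : ∀ q ∈ X \ P, -R < ⟪q, ν⟫_ℝ)
    (hgrain : ∀ q ∈ X \ P, q ∈ (fun p => A p + c) '' barlowStacking 1 (Real.sqrt (2 / 3)) σ)
    (hbudget : ∀ k i j : ℤ, A (barlowPos 1 (Real.sqrt (2 / 3)) σ k i j) + c ∈ X \ P →
      ((P.filter fun p => dist (A (barlowPos 1 (Real.sqrt (2 / 3)) σ k i j) + c) p = 1).card : ℝ) ≤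
        (if (∃ p ∈ P, dist (A (barlowPos 1 (Real.sqrt (2 / 3)) σ k i j) + c) p = 1 ∧
              dist (A (barlowPos 1 (Real.sqrt (2 / 3)) σ k (i + (if s₁ then 1 else -1)) j) + c) p < 1) ∨
            ⟪A (barlowPos 1 (Real.sqrt (2 / 3)) σ k (i + (if s₁ then 1 else -1)) j) + c, ν⟫_ℝ ≤ -R
          then (1 : ℝ) else 0) +
        (if (∃ p ∈ P, dist (A (barlowPos 1 (Real.sqrt (2 / 3)) σ k i j) + c) p = 1 ∧
              dist (A (barlowPos 1 (Real.sqrt (2 / 3)) σ k i (j + (if s₂ then 1 else -1))) + c) p < 1) ∨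
            ⟪A (barlowPos 1 (Real.sqrt (2 / 3)) σ k i (j + (if s₂ then 1 else -1))) + c, ν⟫_ℝ ≤ -R
          then (1 : ℝ) else 0) +
        (if (∃ p ∈ P, dist (A (barlowPos 1 (Real.sqrt (2 / 3)) σ k i j) + c) p = 1 ∧
              dist (A (barlowPos 1 (Real.sqrt (2 / 3)) σ k (i + (if s₃ then 1 else -1))
                (j + (if s₃ then -1 else 1))) + c) p < 1) ∨
            ⟪A (barlowPos 1 (Real.sqrt (2 / 3)) σ k (i + (if s₃ then 1 else -1))
                (j + (if s₃ then -1 else 1))) + c, ν⟫_ℝ ≤ -R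
          then (1 : ℝ) else 0) +
        (((threeOffsets (-σ k)).filter fun o =>
          (∃ p ∈ P, dist (A (barlowPos 1 (Real.sqrt (2 / 3)) σ k i j) + c) p = 1 ∧
              dist (A (barlowPos 1 (Real.sqrt (2 / 3)) σ (k + 1) (i - o.1) (j - o.2)) + c) p < 1) ∨
            ⟪A (barlowPos 1 (Real.sqrt (2 / 3)) σ (k + 1) (i - o.1) (j - o.2)) + c, ν⟫_ℝ ≤ -R).card : ℝ)) :
    ((((P ×ˢ (X \ P)).filter fun pq => dist pq.1 pq.2 = 1).card : ℕ) : ℝ) ≤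
      contactDeficiency (X \ P) := by
  classical
  -- a certified slot carries no film ball
  have hcert : ∀ q ∈ X \ P, ∀ y : EuclideanSpace ℝ (Fin 3),
      ((∃ p ∈ P, dist q p = 1 ∧ dist y p < 1) ∨ ⟪y, ν⟫_ℝ ≤ -R) → y ∉ X \ P := by
    intro q _ y hy hyF
    rcases hy with ⟨p, hp, -, hyp⟩ | hy
    · have hne : y ≠ p := fun h => (mem_sdiff.1 hyF).2 (h ▸ hp)
      have := hX y (mem_sdiff.1 hyF).1 p (hPX hp) hne
      linarith
    · exact absurd (habove y hyF) (not_lt.2 hy)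
  have hind : ∀ q ∈ X \ P, ∀ y : EuclideanSpace ℝ (Fin 3),
      (if (∃ p ∈ P, dist q p = 1 ∧ dist y p < 1) ∨ ⟪y, ν⟫_ℝ ≤ -R then (1 : ℝ) else 0) ≤
        (if y ∉ X \ P then (1 : ℝ) else 0) := by
    intro q hq y
    by_cases hy : (∃ p ∈ P, dist q p = 1 ∧ dist y p < 1) ∨ ⟪y, ν⟫_ℝ ≤ -R
    · rw [if_pos hy, if_pos (hcert q hq y hy)]
    · rw [if_neg hy]; split_ifs <;> norm_num
  refine barlowGrain_cross_le_of_endCredits hσ A c s₁ s₂ s₃ X P hgrain fun k i j hq => ?_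
  refine (hbudget k i j hq).trans ?_
  have h1 := hind _ hq (A (barlowPos 1 (Real.sqrt (2 / 3)) σ k (i + (if s₁ then 1 else -1)) j) + c)
  have h2 := hind _ hq (A (barlowPos 1 (Real.sqrt (2 / 3)) σ k i (j + (if s₂ then 1 else -1))) + c)
  have h3 := hind _ hq (A (barlowPos 1 (Real.sqrt (2 / 3)) σ k (i + (if s₃ then 1 else -1))
    (j + (if s₃ then -1 else 1))) + c)
  have h4 : (((threeOffsets (-σ k)).filter fun o =>
      (∃ p ∈ P, dist (A (barlowPos 1 (Real.sqrt (2 / 3)) σ k i j) + c) p = 1 ∧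
          dist (A (barlowPos 1 (Real.sqrt (2 / 3)) σ (k + 1) (i - o.1) (j - o.2)) + c) p < 1) ∨
        ⟪A (barlowPos 1 (Real.sqrt (2 / 3)) σ (k + 1) (i - o.1) (j - o.2)) + c, ν⟫_ℝ ≤ -R).card : ℝ) ≤
      (((threeOffsets (-σ k)).filter fun o =>
        A (barlowPos 1 (Real.sqrt (2 / 3)) σ (k + 1) (i - o.1) (j - o.2)) + c ∉ X \ P).card : ℝ) := by
    exact_mod_cast card_le_card (fun o ho => by
      rw [mem_filter] at ho ⊢
      exact ⟨ho.1, hcert _ hq _ ho.2⟩)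
  linarith

/-- **RUNG-REDUCTION (registered by name on stmt-Ventures-19144): the slot-certificate reduction for
misoriented grains of ANY Barlow stacking at ANY tilt.**  `∀`-form of
`barlowGrain_cross_le_of_slotCertificates`: if every film ball of a grain `A · barlowStacking 1 √(2/3) σ + c`
(film above the cut `−R`) has at most as many substrate contacts as CERTIFIED-EMPTY end slots (blocked by
one of its own substrate contacts, or submerged below the cut) among its three oriented in-layer ends and its
three up-neighbour slots, then `#cross(P, X∖P) ≤ D(X∖P)`.  The per-ball hypothesis is the PRED-SLOT
BUDGET of the line's census (memo PREDBUDGET-g13.md). -/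
theorem barlowGrain_slotCertificate_reduction :
    ∀ σ : ℤ → ℤ, IsHaggSeq σ →
      ∀ (A : EuclideanSpace ℝ (Fin 3) ≃ₗᵢ[ℝ] EuclideanSpace ℝ (Fin 3)) (c ν : EuclideanSpace ℝ (Fin 3)) (R : ℝ)
        (s₁ s₂ s₃ : Bool) (X P : Finset (EuclideanSpace ℝ (Fin 3))),
      (∀ p ∈ X, ∀ q ∈ X, p ≠ q → 1 ≤ dist p q) → P ⊆ X →
      (∀ q ∈ X \ P, -R < ⟪q, ν⟫_ℝ) →
      (∀ q ∈ X \ P, q ∈ (fun p => A p + c) '' barlowStacking 1 (Real.sqrt (2 / 3)) σ) →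
      (∀ k i j : ℤ, A (barlowPos 1 (Real.sqrt (2 / 3)) σ k i j) + c ∈ X \ P →
        ((P.filter fun p => dist (A (barlowPos 1 (Real.sqrt (2 / 3)) σ k i j) + c) p = 1).card : ℝ) ≤
          (if (∃ p ∈ P, dist (A (barlowPos 1 (Real.sqrt (2 / 3)) σ k i j) + c) p = 1 ∧
                dist (A (barlowPos 1 (Real.sqrt (2 / 3)) σ k (i + (if s₁ then 1 else -1)) j) + c) p < 1) ∨
              ⟪A (barlowPos 1 (Real.sqrt (2 / 3)) σ k (i + (if s₁ then 1 else -1)) j) + c, ν⟫_ℝ ≤ -R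
            then (1 : ℝ) else 0) +
          (if (∃ p ∈ P, dist (A (barlowPos 1 (Real.sqrt (2 / 3)) σ k i j) + c) p = 1 ∧
                dist (A (barlowPos 1 (Real.sqrt (2 / 3)) σ k i (j + (if s₂ then 1 else -1))) + c) p < 1) ∨
              ⟪A (barlowPos 1 (Real.sqrt (2 / 3)) σ k i (j + (if s₂ then 1 else -1))) + c, ν⟫_ℝ ≤ -R
            then (1 : ℝ) else 0) +
          (if (∃ p ∈ P, dist (A (barlowPos 1 (Real.sqrt (2 / 3)) σ k i j) + c) p = 1 ∧
                dist (A (barlowPos 1 (Real.sqrt (2 / 3)) σ k (i + (if s₃ then 1 else -1))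
                  (j + (if s₃ then -1 else 1))) + c) p < 1) ∨
              ⟪A (barlowPos 1 (Real.sqrt (2 / 3)) σ k (i + (if s₃ then 1 else -1))
                  (j + (if s₃ then -1 else 1))) + c, ν⟫_ℝ ≤ -R
            then (1 : ℝ) else 0) +
          (((threeOffsets (-σ k)).filter fun o =>
            (∃ p ∈ P, dist (A (barlowPos 1 (Real.sqrt (2 / 3)) σ k i j) + c) p = 1 ∧
                dist (A (barlowPos 1 (Real.sqrt (2 / 3)) σ (k + 1) (i - o.1) (j - o.2)) + c) p < 1) ∨
              ⟪A (barlowPos 1 (Real.sqrt (2 / 3)) σ (k + 1) (i - o.1) (j - o.2)) + c, ν⟫_ℝ ≤ -R).card : ℝ)) →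
      ((((P ×ˢ (X \ P)).filter fun pq => dist pq.1 pq.2 = 1).card : ℕ) : ℝ) ≤
        contactDeficiency (X \ P) :=
  fun _ hσ A c ν R s₁ s₂ s₃ X P hX hPX habove hgrain hbudget =>
    barlowGrain_cross_le_of_slotCertificates hσ A c ν R s₁ s₂ s₃ X P hX hPX habove hgrain hbudget

end Summit.Ventures.Crystal3D.Theorems

end
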